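import Mathlib
import Summits.KontsevichZagierPeriods.KontsevichZagierPeriods.Theorems.SoloInformedInversionChain
import HarnessLib
import HarnessLib.Audit

/-!
# W12 by two quadratic moves (solo-informed, s23): a genus-0 derivation

THEOREM XI″ (KERNEL). The cycle relation W12 of the level-6 census,
`⟦β(⅙,⅓)⟧ = 2 · ⟦β(⅓,½)⟧`, first derived by the CM-torsion chain of Theorem X
(`soloInformed_torsion_W12_swap`, five substitutions of positive genus origin), ALSO follows from
TWO QUADRATIC substitutions and nothing else:

* the inversion move at `a = ⅓` (Theorem XI): `⟦[pt,4^{1/3}]⟧ · ⟦β(⅓,⅓)⟧ = ⟦β(⅙,⅓)⟧`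
  (`u = ((1−t)/(1+t))²`), and
* the duplication move at `a = ⅓` (Theorem IX⁗(iii)): `⟦[pt,4^{1/3}]⟧ · ⟦β(⅓,⅓)⟧ = 2 · ⟦β(⅓,½)⟧`
  (`u = 4t(1−t)` after halving),

both pivoting on the symmetric class `⟦β(⅓,⅓)⟧`; no class is cancelled (the two right-hand sides
are equal to the same left-hand side).  This file records that second derivation in the kernel,
so that the census of §6octies can state honestly: W12 and W14 are visible to the genus-0
calculus once the inversion quotient is admitted; the torsion chain remains the first move of
positive genus and the template for the second-kind relations W25, W35, W45, which no direct
one-variable substitution reaches (Theorem XII of the paper, Riemann–Hurwitz).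

References: M. Kontsevich, D. Zagier, *Periods* (2001), §1.2; Andrews–Askey–Roy (1999),
Thm. 1.5.1; this work (solo-informed s23).
-/

noncomputable section

open MeasureTheory Set Filter

open Literature.NumberTheory.Transcendental Literature.NumberTheory.Transcendental.KZ
open Literature.ModelTheory.ExponentialFields

namespace Summit.KontsevichZagierPeriods.KontsevichZagierPeriods.Theorems

/-- **THEOREM XI″ (W12 by two quadratic moves).** For pinned `B₂₂ = β(⅓,⅓)`, `B₆₃ = β(⅙,⅓)`,
`B₃₂ = β(⅓,½)`: the inversion move gives `⟦[pt,4^{1/3}]⟧·⟦B₂₂⟧ = ⟦B₆₃⟧`, the duplication move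
gives `⟦[pt,4^{1/3}]⟧·⟦B₂₂⟧ = 2⟦B₃₂⟧`, hence `⟦B₆₃⟧ = 2⟦B₃₂⟧` — with no positive-genus move and
no cancellation. [this work] -/
theorem soloInformed_W12_by_quadratic_moves (h4 : IsAlgebraic ℚ ((4:ℝ) ^ (((1 / 3 : ℚ)) : ℝ)))
    (B₂₂ B₆₃ B₃₂ : IntegralRep 1)
    (h22d : B₂₂.domain = {t | t 0 ∈ Ioo (0:ℝ) 1})
    (h22i : EqOn B₂₂.integrand
      (fun t => (t 0) ^ (((1 / 3 : ℚ) : ℝ) - 1) * (1 - t 0) ^ (((1 / 3 : ℚ) : ℝ) - 1))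
      B₂₂.domain)
    (h63d : B₆₃.domain = {t | t 0 ∈ Ioo (0:ℝ) 1})
    (h63i : EqOn B₆₃.integrand
      (fun t => (t 0) ^ (((1 / 6 : ℚ) : ℝ) - 1) * (1 - t 0) ^ (((1 / 3 : ℚ) : ℝ) - 1))
      B₆₃.domain)
    (h32d : B₃₂.domain = {t | t 0 ∈ Ioo (0:ℝ) 1})
    (h32i : EqOn B₃₂.integrand
      (fun t => (t 0) ^ (((1 / 3 : ℚ) : ℝ) - 1) * (1 - t 0) ^ (((1 / 2 : ℚ) : ℝ) - 1))
      B₃₂.domain) :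
    (toFormalPeriod (of (IntegralRep.unit.constMul ((4:ℝ) ^ (((1 / 3 : ℚ)) : ℝ)) h4)) *
        toFormalPeriod (of B₂₂) = toFormalPeriod (of B₆₃)) ∧
      toFormalPeriod (of B₆₃) = 2 * toFormalPeriod (of B₃₂) := by
  -- the inversion move at `a = ⅓`: `A = β(⅓, 1 − ⅔) = B₂₂`, `B = β(½ − ⅓, ⅓) = B₆₃`
  have hA : EqOn B₂₂.integrand (fun t => (t 0) ^ (((1 / 3 : ℚ) : ℝ) - 1) *
      (1 - t 0) ^ (((1 - 2 * (1 / 3) : ℚ) : ℝ) - 1)) B₂₂.domain := fun x hx => by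
    rw [h22i hx]
    norm_num
  have hB : EqOn B₆₃.integrand (fun t => (t 0) ^ (((1 / 2 - 1 / 3 : ℚ) : ℝ) - 1) *
      (1 - t 0) ^ (((1 / 3 : ℚ) : ℝ) - 1)) B₆₃.domain := fun x hx => by
    rw [h63i hx]
    norm_num
  have hinv := soloInformed_inversion_chain (1 / 3) h4 B₂₂ B₆₃ h22d hA h63d hB
  -- the duplication move at `a = ⅓`
  have hdup := soloInformed_duplication_chain (1 / 3) h4 B₂₂ B₃₂ h22d h22i h32d h32i
  exact ⟨hinv, by rw [← hinv, hdup]⟩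

/-- **Value form**: `4^{1/3}·B(⅓,⅓) = B(⅙,⅓) = 2·B(⅓,½)` (the two quadratic Beta incarnations of
Legendre's duplication at `z = ⅓` and `z = ⅙`, as consequences of two moves). [this work] -/
theorem soloInformed_W12_by_quadratic_moves_value (B₂₂ B₆₃ B₃₂ : IntegralRep 1)
    (h22d : B₂₂.domain = {t | t 0 ∈ Ioo (0:ℝ) 1})
    (h22i : EqOn B₂₂.integrand
      (fun t => (t 0) ^ (((1 / 3 : ℚ) : ℝ) - 1) * (1 - t 0) ^ (((1 / 3 : ℚ) : ℝ) - 1))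
      B₂₂.domain)
    (h63d : B₆₃.domain = {t | t 0 ∈ Ioo (0:ℝ) 1})
    (h63i : EqOn B₆₃.integrand
      (fun t => (t 0) ^ (((1 / 6 : ℚ) : ℝ) - 1) * (1 - t 0) ^ (((1 / 3 : ℚ) : ℝ) - 1))
      B₆₃.domain)
    (h32d : B₃₂.domain = {t | t 0 ∈ Ioo (0:ℝ) 1})
    (h32i : EqOn B₃₂.integrand
      (fun t => (t 0) ^ (((1 / 3 : ℚ) : ℝ) - 1) * (1 - t 0) ^ (((1 / 2 : ℚ) : ℝ) - 1))
      B₃₂.domain) :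
    (4:ℝ) ^ (((1 / 3 : ℚ)) : ℝ) * B₂₂.value = B₆₃.value ∧ B₆₃.value = 2 * B₃₂.value := by
  have h4 : IsAlgebraic ℚ ((4:ℝ) ^ (((1 / 3 : ℚ)) : ℝ)) := by
    simpa using soloInformed_isAlgebraic_natCast_rpow_ratCast 4 (by norm_num) (1 / 3)
  obtain ⟨h₁, h₂⟩ := soloInformed_W12_by_quadratic_moves h4 B₂₂ B₆₃ B₃₂ h22d h22i h63d h63i
    h32d h32i
  have e₁ := congr_arg evalP h₁
  have e₂ := congr_arg evalP h₂
  rw [map_mul, evalP_toFormalPeriod_of, evalP_toFormalPeriod_of, evalP_toFormalPeriod_of,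
    IntegralRep.value_constMul, IntegralRep.value_unit, mul_one] at e₁
  rw [map_mul, evalP_toFormalPeriod_of, evalP_toFormalPeriod_of, map_ofNat] at e₂
  exact ⟨e₁, e₂⟩

end Summit.KontsevichZagierPeriods.KontsevichZagierPeriods.Theorems

end
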